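import Literature.NumberTheory.EllipticCurves.YanZhu2026.GreenbergDivisibilityAwayFromCycProofs
import Literature.NumberTheory.EllipticCurves.BurungaleCastellaSkinner2025.GreenbergMuInvariantProofs
import Literature.NumberTheory.EllipticCurves.BurungaleCastellaSkinner2025.OrdinaryGreenbergEquivalence
import Literature.RingTheory.PowerSeries.AdicCompletenessWeierstrassDivisibility
import Mathlib.Analysis.SpecificLimits.Basic
import HarnessLib

/-!
# Yan–Zhu 2026 (J. Algebra 693 = arXiv:2412.20078v4), proof of Thm. 4.2 (2), SECOND STEP (v4 l.1042–1050)
# — PROVED: "`μ(𝓛_p^Gr(E/K)⁻) = μ(𝓛_p^BDP(E/K)) = 0` … Hence `ord_P(𝓛_p^Gr(E/K)) = 0` if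
# `P = P⁺Λ_K^ur` … It implies that `Char_{Λ_K}(𝒳_{𝓕_Gr}(E/K_∞))Λ_K^ur ⊂ (𝓛_p^Gr(E/K))`"

`Proofs` companion (theorems only: no definition, no named fact, no instance) of
`YanZhu2026/GreenbergMainTheoremsAnyRoot.lean` and `YanZhu2026/GreenbergDivisibilityAwayFromCycProofs.lean`
(seat `bsd-littype-04`, gen 4/5; OPEN-QUESTIONS-04 Q23). It REPLAYS IN THE KERNEL the second half of the
printed proof of Theorem 4.2 (2) (arXiv v4 TeX l.1042–1050, [corpus:paper:arxiv-2412.20078 p0011 L1–L21]):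

> "We may assume that `S` is generated by prime elements in the unique factorization domain `Λ_K`. For
> height one prime `P ⊂ Λ_K^ur`, if `P ∩ S ≠ ∅`, we have `P = P⁺Λ_K^ur` for some `P⁺ ⊂ Λ_K^{ur,+}`.
> However, by [Hsieh14] and Proposition 3.14, `μ(𝓛_p^Gr(E/K)⁻) = μ(𝓛_p^BDP(E/K)) = 0`. Hence
> `ord_P(𝓛_p^Gr(E/K)) = 0` if `P = P⁺Λ_K^ur`. It implies that
> `Char_{Λ_K}(𝒳_{𝓕_Gr}(E/K_∞))Λ_K^ur ⊂ (𝓛_p^Gr(E/K))`."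

over the tree's receptacle `𝒪_{ℂ_p}⟦T₁⟧⟦T₂⟧` of `Λ_K^ur` ((T1) of `GreenbergMainTheorems.lean`; outer
variable `T₁` = cyclotomic, inner `T₂` = anticyclotomic), which is NOT factorial (`𝒪_{ℂ_p}` is not
noetherian). The printed UFD argument is replaced by Weierstrass DIVISION in the anticyclotomic variable:

* §A `𝒪_{ℂ_p}` is `(ϖ)`-adically complete for every `ϖ` with `‖ϖ‖ < 1`
  (`isAdicComplete_padicComplexInt_span_singleton`; the closed unit ball of the complete field `ℂ_p`).
* §B **the cancellation theorem** `dvd_of_dvd_map_C_mul_of_hasUnitContent_minus`: if `G ∈ 𝒪_{ℂ_p}⟦T₁⟧⟦T₂⟧`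
  has `μ(G⁻) = 0` in the tree's sense (`HasUnitContent (minus G)`: a unit among the coefficients of
  `G(0, T₂)`) then `G ∣ t·c ⇒ G ∣ c` for every nonzero CYCLOTOMIC series `t ∈ 𝒪_{ℂ_p}⟦T₁⟧`. Proof: let
  `n` be the least index of a unit coefficient of `G⁻` and `ϖ` a lower coefficient of largest norm; after
  swapping the variables (`Literature.RingTheory.PowerSeries.exists_ringEquiv_powerSeries_swap`) `G` is
  a Weierstrass divisor of order `n` in `B⟦T₂⟧`, `B = 𝒪_{ℂ_p}⟦T₁⟧`, at the ideal `J = (ϖ, T₁)` for which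
  `B` is complete (§A + `….isAdicComplete_powerSeries_map_C_sup_span_X`, Bourbaki AC III §2 no. 6), so
  `B⟦T₂⟧/(G)` is a free `B`-module (Bourbaki AC VII §3 no. 8 Prop. 5; Mathlib's `mod'`) and has no
  `t`-torsion. This is exactly the content of the printed "`ord_P(𝓛_p^Gr) = 0` for `P = P⁺Λ_K^ur`": no
  divisor of `G` comes from the cyclotomic algebra.
* §C **Theorem 4.2 (2) "⊂" and Theorem 4.2 (1) "⊂" assembled from their printed inputs**: granted the
  named facts `cor46_…` (Cor. 4.6: Hida theory + [SU14]), `thm47_…AnyRoot…` (Thm. 4.7: the Beilinson–Flach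
  equivalence; cell flag `YZ26@3-BF-ERL-Ohta` at `p = 3`), `prop314_…_anyRoot` (Prop. 3.14 = [CGS25,
  Prop. 2.4.5]) and `BurungaleCastellaSkinner2025.prop422_…` (the `μ(𝓛_p^BDP) = 0` input = [Hsieh14,
  Thm. B]), under `GreenbergSetting` + (Heeg) + irreducibility of `ρ̄_E|_{G_K}`:
  `Char(X_Gr)·𝒪_{ℂ_p}⟦T₁,T₂⟧ ⊆ (G)` for EVERY Katz/Greenberg frame `(LK, G)` and every structure-compatible
  `J` (`charIdealXGr₂_map_le_span_of_facts`); with the frame-existence fact `thm39_def311_…AnyRoot₂` the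
  `∃`-form in the shape of `thm42_XGr₂_isTorsion_charIdeal_le_greenbergAnyRoot`'s inclusion clause
  (`exists_frames_charIdealXGr₂_map_le_span_of_facts`), and through Thm. 4.7 at `S = {1}` the ORDINARY
  inclusion `Char(X_ord) ⊂ (𝓛_p^PR)` of Thm. 4.2 (1) (`idealLeSpan_perrinRiou_of_facts`).

* §D **the torsion clause of Theorem 4.2 (2)** ("`𝒳_{𝓕_Gr}(E/K_∞)` is `Λ_K`-torsion"), granted in addition
  Cor. 2.9 (`cor29_XOrd₂_isTorsion`: `X_ord` torsion) and [BCS25, Thm. 4.1.3]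
  (`BurungaleCastellaSkinner2025.thm413_…`, the torsion transfer ord → Gr at `S = {1}`, littype-03's
  `xGr₂_isTorsion_of_thm413`): `xGr₂_isTorsion_of_facts`, and the bundled `∃`-form
  `exists_frames_isTorsion_charIdealXGr₂_map_le_span_of_facts` = LITERALLY the conclusion of
  `thm42_XGr₂_isTorsion_charIdeal_le_greenbergAnyRoot` with its (Im) clause removed.
* §E **rational ⟹ integral for one curve**: `IdealLeSpanAway p (Char X_ord) (𝓛_p^PR)` ("in `Λ_K ⊗ ℚ_p`")
  + `μ(G⁻) = 0` ⟹ both integral divisibilities, via Thm. 4.7 at `S = {pⁿ}`, the cancellation, and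
  Thm. 4.7 at `S = {1}` (`idealLeSpan_and_charIdealXGr₂_map_le_span_of_rational_of_thm47_of_hasUnitContent_minus`).

So the inclusions of [YZ26, Thm. 4.2] now hold in the kernel MODULO THEIR FOUR PRINTED INPUTS (all refereed
named facts of the tree) instead of being taken as the named fact `thm42_…AnyRoot` — a faithfulness
validation of the §3–§4 transcription (the binders compose as print uses them). Hypotheses are print's
except: irreducibility instead of absolute irreducibility (print needs the latter only for the (Im)
equality, not replayed here), and (disc) through `GreenbergSetting` (used by print via Prop. 3.14,
OPEN-QUESTIONS-04 Q15). NOT replayed: the (Im) equality ([Kato] + "a commutative algebra lemma" of [SU14], v4 l.1050–1056) —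
OPEN-QUESTIONS-04 Q24 (b); the torsion clause of §D uses [BCS25, Thm. 4.1.3] where print cites its own
Thm. 4.7 + Cor. 2.9 (Yan–Zhu's Thm. 4.7 as printed carries no torsion clause, OPEN-QUESTIONS-03 OQ-14).

## References
* [YanZhu2024MainConjNonCM] X. Yan, X. Zhu, J. Algebra 693 (2026) = arXiv:2412.20078v4, proof of Thm. 4.2,
  TeX l.1036–1056 [corpus:paper:arxiv-2412.20078 p0010 L112 – p0011 L21]; Thm. 4.7 (l.1022–1034), Cor. 4.6
  (l.996–1003), Prop. 3.14 (l.896–903), Thm. 3.9/Def. 3.11 (l.839–871).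
* [BurungaleCastellaSkinner2025] Prop. 4.2.2 (`μ(L_p^Gr) = μ(L_p^BDP) = 0`), arXiv:2405.00270v2 p. 9.
* [Hsieh2014] Thm. B. [Bourbaki1989CommAlg] III §2 no. 6 Prop. 6. [BourbakiAC5to7] VII §3 no. 8 Prop. 5.
-/

noncomputable section

open scoped Classical

open Filter PowerSeries NumberField IsDedekindDomain Field CongruenceSubgroup
  Literature.NumberTheory.GaloisRepresentations Literature.NumberTheory.EllipticCurves
  Literature.NumberTheory.EllipticCurves.ModularForms Literature.NumberTheory.EllipticCurves.Rank1Residual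
  Literature.RingTheory.PowerSeries

namespace Literature.NumberTheory.EllipticCurves

/-! ## §A. `𝒪_{ℂ_p}` is `(ϖ)`-adically complete (`‖ϖ‖ < 1`) -/

section PadicComplexIntAdic

variable {p : ℕ} [Fact p.Prime]

/-- In `𝒪_{ℂ_p}`: if `‖x‖ ≤ ‖y‖` then `y ∣ x` (valuation ring; for `y = 0` this forces `x = 0`).
[cite: YanZhu2024MainConjNonCM, §3.4 (Λ_K^ur = Λ_K ⊗̂ ℤ_p^ur ⊂ 𝒪⟦Γ_K⟧, arXiv:2412.20078v4 TeX l.851) — bookkeeping for the receptacle (T1)] -/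
theorem padicComplexInt_dvd_of_norm_le {x y : PadicComplexInt p}
    (h : ‖(x : ℂ_[p])‖ ≤ ‖(y : ℂ_[p])‖) : y ∣ x := by
  by_cases hy : (y : ℂ_[p]) = 0
  · have hx : (x : ℂ_[p]) = 0 := by
      rw [hy, norm_zero] at h
      exact norm_eq_zero.mp (le_antisymm h (norm_nonneg _))
    have hx' : x = 0 := Subtype.ext hx
    rw [hx']
    exact dvd_zero y
  · have hq : (x : ℂ_[p]) / (y : ℂ_[p]) ∈ PadicComplexInt p := by
      rw [mem_padicComplexInt_iff, norm_div]
      exact div_le_one_of_le₀ h (norm_nonneg _)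
    refine ⟨⟨_, hq⟩, Subtype.ext ?_⟩
    change (x : ℂ_[p]) = (y : ℂ_[p]) * ((x : ℂ_[p]) / (y : ℂ_[p]))
    rw [mul_div_cancel₀ _ hy]

/-- `x ∈ (ϖ)ⁿ ⇒ ‖x‖ ≤ ‖ϖ‖ⁿ` in `𝒪_{ℂ_p}`.
[cite: YanZhu2024MainConjNonCM, §3.4 (the coefficient ring of Λ_K^ur, arXiv:2412.20078v4 TeX l.851) — bookkeeping] -/
theorem norm_le_of_mem_span_singleton_pow {ϖ x : PadicComplexInt p} {n : ℕ}
    (h : x ∈ Ideal.span {ϖ} ^ n) : ‖(x : ℂ_[p])‖ ≤ ‖(ϖ : ℂ_[p])‖ ^ n := by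
  rw [Ideal.span_singleton_pow] at h
  obtain ⟨c, rfl⟩ := Ideal.mem_span_singleton'.mp h
  push_cast
  rw [norm_mul, norm_pow]
  exact mul_le_of_le_one_left (pow_nonneg (norm_nonneg _) n) (norm_coe_padicComplexInt_le_one c)

/-- `‖x‖ ≤ ‖ϖ‖ⁿ ⇒ x ∈ (ϖ)ⁿ` in `𝒪_{ℂ_p}`.
[cite: YanZhu2024MainConjNonCM, §3.4 (the coefficient ring of Λ_K^ur, arXiv:2412.20078v4 TeX l.851) — bookkeeping] -/
theorem mem_span_singleton_pow_of_norm_le {ϖ x : PadicComplexInt p} {n : ℕ}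
    (h : ‖(x : ℂ_[p])‖ ≤ ‖(ϖ : ℂ_[p])‖ ^ n) : x ∈ Ideal.span {ϖ} ^ n := by
  rw [Ideal.span_singleton_pow]
  refine Ideal.mem_span_singleton.mpr (padicComplexInt_dvd_of_norm_le ?_)
  push_cast
  rwa [norm_pow]

/-- **`𝒪_{ℂ_p}` is `(ϖ)`-adically separated and complete for every `ϖ ∈ 𝒪_{ℂ_p}` with `‖ϖ‖ < 1`**: a
`(ϖ)`-adic Cauchy sequence is norm-Cauchy in the complete field `ℂ_p`, its limit lies in the closed
unit ball, and `‖x‖ ≤ ‖ϖ‖ⁿ` for all `n` forces `x = 0`. (For `ϖ = 0` the ideal is `⊥`.) This is the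
completeness of the coefficient ring of the receptacle `𝒪_{ℂ_p}⟦T₁⟧⟦T₂⟧ ⊇ Λ_K^ur`.
[cite: YanZhu2024MainConjNonCM, §3.4 (Λ_K^ur = Λ_K ⊗̂_{ℤ_p} ℤ_p^ur, ℤ_p^ur "the completion of the ring of integers of the maximal unramified extension of ℚ_p", arXiv:2412.20078v4 TeX l.851)] -/
theorem isAdicComplete_padicComplexInt_span_singleton {ϖ : PadicComplexInt p}
    (hϖ : ‖(ϖ : ℂ_[p])‖ < 1) : IsAdicComplete (Ideal.span {ϖ}) (PadicComplexInt p) := by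
  have hsmul : ∀ (k : ℕ) (x : PadicComplexInt p),
      x ∈ (Ideal.span {ϖ} ^ k • ⊤ : Submodule (PadicComplexInt p) (PadicComplexInt p)) ↔
        x ∈ Ideal.span {ϖ} ^ k := fun k x ↦ by rw [smul_eq_mul, Ideal.mul_top]
  refine { haus' := fun x hx ↦ ?_, prec' := fun f hf ↦ ?_ }
  · -- separated
    have hle : ∀ n : ℕ, ‖(x : ℂ_[p])‖ ≤ ‖(ϖ : ℂ_[p])‖ ^ n := fun n ↦
      norm_le_of_mem_span_singleton_pow ((hsmul n x).1 (by simpa [SModEq.zero] using hx n))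
    have h0 : ‖(x : ℂ_[p])‖ ≤ 0 :=
      ge_of_tendsto' (tendsto_pow_atTop_nhds_zero_of_lt_one (norm_nonneg _) hϖ) hle
    exact Subtype.ext (norm_eq_zero.mp (le_antisymm h0 (norm_nonneg _)))
  · -- precomplete
    have hdist : ∀ {m n : ℕ}, m ≤ n →
        ‖((f m : PadicComplexInt p) : ℂ_[p]) - ((f n : PadicComplexInt p) : ℂ_[p])‖ ≤
          ‖(ϖ : ℂ_[p])‖ ^ m := by
      intro m n hmn
      have h := (hsmul m _).1 (SModEq.sub_mem.1 (hf hmn))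
      have h' := norm_le_of_mem_span_singleton_pow h
      push_cast at h'
      exact h'
    have hcauchy : CauchySeq fun n ↦ ((f n : PadicComplexInt p) : ℂ_[p]) :=
      cauchySeq_of_le_geometric _ 1 hϖ fun n ↦ by
        rw [dist_eq_norm, one_mul]
        exact hdist (Nat.le_succ n)
    obtain ⟨L, hL⟩ := cauchySeq_tendsto_of_complete hcauchy
    have hL1 : L ∈ PadicComplexInt p := by
      rw [mem_padicComplexInt_iff]
      exact le_of_tendsto' ((continuous_norm.tendsto L).comp hL) fun n ↦
        norm_coe_padicComplexInt_le_one (f n)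
    refine ⟨⟨L, hL1⟩, fun m ↦ SModEq.sub_mem.2 ((hsmul m _).2 (mem_span_singleton_pow_of_norm_le ?_))⟩
    push_cast
    have ht : Tendsto (fun n ↦ ‖((f m : PadicComplexInt p) : ℂ_[p]) - ((f n : PadicComplexInt p) : ℂ_[p])‖)
        atTop (nhds ‖((f m : PadicComplexInt p) : ℂ_[p]) - L‖) :=
      (tendsto_const_nhds.sub hL).norm
    exact le_of_tendsto ht (Filter.eventually_atTop.2 ⟨m, fun n hn ↦ hdist hn⟩)

/-- `(ϖ) ≠ 𝒪_{ℂ_p}` when `‖ϖ‖ < 1`.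
[cite: YanZhu2024MainConjNonCM, §3.4 (arXiv:2412.20078v4 TeX l.851) — bookkeeping] -/
theorem span_singleton_padicComplexInt_ne_top {ϖ : PadicComplexInt p} (hϖ : ‖(ϖ : ℂ_[p])‖ < 1) :
    Ideal.span {ϖ} ≠ ⊤ := by
  rw [Ne, Ideal.span_singleton_eq_top, isUnit_padicComplexInt_iff]
  exact hϖ.ne

end PadicComplexIntAdic

/-! ## §B. Cancellation of cyclotomic factors against a series with `μ⁻ = 0` -/

section Cancellation

variable {p : ℕ} [Fact p.Prime]

open UnrSeries₂ GreenbergVatsal2000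

/-- **"`ord_P(𝓛) = 0` for every `P = P⁺Λ_K^ur` when `μ(𝓛⁻) = 0`" as a cancellation law in
`𝒪_{ℂ_p}⟦T₁⟧⟦T₂⟧**: if some coefficient of `G⁻ = G(0, T₂)` is a unit (`HasUnitContent (minus G)`), then
for every NONZERO cyclotomic series `t ∈ 𝒪_{ℂ_p}⟦T₁⟧` (placed in the outer variable: `map C t`) and
every `c`, `G ∣ t · c ⇒ G ∣ c`. Proof (replacing the printed UFD argument, unavailable over `𝒪_{ℂ_p}`):
with `n` the least index of a unit coefficient of `G⁻` and `ϖ` a lower coefficient of largest norm, after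
swapping the variables `G` is a Weierstrass divisor of order `n` at `J = (ϖ, T₁) ⊂ B = 𝒪_{ℂ_p}⟦T₁⟧`, `B`
is `J`-adically complete (§A + Bourbaki AC III §2 no. 6), so `B⟦T₂⟧/(G) ↪ B[T₂]` `B`-linearly
(Bourbaki AC VII §3 no. 8 Prop. 5 / Mathlib's `mod'`) and has no `t`-torsion.
[cite: YanZhu2024MainConjNonCM, proof of Thm. 4.2 (2), second display ("μ(𝓛_p^Gr(E/K)⁻) = 0 … Hence ord_P(𝓛_p^Gr(E/K)) = 0 if P = P⁺Λ_K^ur", arXiv:2412.20078v4 TeX l.1042–1048)] -/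
theorem dvd_of_dvd_map_C_mul_of_hasUnitContent_minus {G c : PowerSeries (PowerSeries (PadicComplexInt p))}
    (hG : HasUnitContent (minus G)) {t : PowerSeries (PadicComplexInt p)} (ht : t ≠ 0)
    (h : G ∣ PowerSeries.map (PowerSeries.C (R := PadicComplexInt p)) t * c) : G ∣ c := by
  -- the least index of a unit coefficient of `G⁻`
  have hex : ∃ n, IsUnit (PowerSeries.coeff n (minus G)) := hG
  set n := Nat.find hex with hn_def
  have hn : IsUnit (PowerSeries.coeff n (minus G)) := Nat.find_spec hex
  have hlt : ∀ j < n, ¬ IsUnit (PowerSeries.coeff j (minus G)) := fun j hj ↦ Nat.find_min hex hj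
  -- a lower coefficient `ϖ` of largest norm (or `0` if `n = 0`)
  obtain ⟨ϖ, hϖ, hmem⟩ : ∃ ϖ : PadicComplexInt p, ‖(ϖ : ℂ_[p])‖ < 1 ∧
      ∀ j < n, PowerSeries.coeff j (minus G) ∈ Ideal.span {ϖ} := by
    by_cases hn0 : n = 0
    · exact ⟨0, by simp, fun j hj ↦ absurd hj (by omega)⟩
    · obtain ⟨j₀, hj₀, hmax⟩ := (Finset.range n).exists_max_image
        (fun j ↦ ‖((PowerSeries.coeff j (minus G) : PadicComplexInt p) : ℂ_[p])‖)
        (Finset.nonempty_range_iff.mpr hn0)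
      refine ⟨PowerSeries.coeff j₀ (minus G), ?_, fun j hj ↦ ?_⟩
      · exact lt_of_le_of_ne (norm_coe_padicComplexInt_le_one _) fun h1 ↦
          hlt j₀ (Finset.mem_range.mp hj₀) (isUnit_padicComplexInt_iff.mpr h1)
      · exact Ideal.mem_span_singleton.mpr
          (padicComplexInt_dvd_of_norm_le (hmax j (Finset.mem_range.mpr hj)))
  -- the ideal `J = (ϖ, T₁)` of `B = 𝒪⟦T₁⟧`, for which `B` is complete
  set I : Ideal (PadicComplexInt p) := Ideal.span {ϖ} with hI_def
  haveI : IsAdicComplete I (PadicComplexInt p) := isAdicComplete_padicComplexInt_span_singleton hϖ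
  set J : Ideal (PowerSeries (PadicComplexInt p)) :=
    I.map (PowerSeries.C (R := PadicComplexInt p)) ⊔ Ideal.span {PowerSeries.X} with hJ_def
  haveI : IsAdicComplete J (PowerSeries (PadicComplexInt p)) :=
    isAdicComplete_powerSeries_map_C_sup_span_X I
  have hJ : J ≠ ⊤ := map_C_sup_span_X_ne_top I (span_singleton_padicComplexInt_ne_top hϖ)
  -- swap the variables: `G` becomes a Weierstrass divisor of order `n` at `J`
  obtain ⟨σ, hσ⟩ := exists_ringEquiv_powerSeries_swap (R := PadicComplexInt p)
  have hW : (σ G).IsWeierstrassDivisorAt J := by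
    refine isWeierstrassDivisorAt_of_coeff_mem_of_isUnit hJ (n := n) (fun j hj ↦ ?_) ?_
    · have h1 : PowerSeries.coeff j (σ G) ∈ J ^ 1 := by
        refine mem_map_C_sup_span_X_pow_of_coeff_mem_pow I fun i ↦ ?_
        cases i with
        | zero =>
          rw [hσ, Nat.sub_zero, pow_one, PowerSeries.coeff_zero_eq_constantCoeff_apply]
          exact hmem j hj
        | succ i => simp
      simpa using h1
    · rw [PowerSeries.isUnit_iff_constantCoeff, constantCoeff_coeff_swap hσ]
      exact hn
  -- transport the divisibility through `σ` and cancel `t`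
  have h' : σ G ∣ PowerSeries.C t * σ c := by
    have h1 := map_dvd σ h
    rwa [map_mul, (swap_C_eq_map_C hσ t).2] at h1
  have h'' : σ G ∣ σ c := dvd_of_isWeierstrassDivisorAt_of_dvd_C_mul hW ht h'
  simpa using map_dvd σ.symm h''

/-- **Ideal form**: `(t)·𝔞 ⊆ (G)` with `t ∈ 𝒪_{ℂ_p}⟦T₁⟧` nonzero and `μ(G⁻) = 0` implies `𝔞 ⊆ (G)` —
"`S⁻¹𝔞 ⊂ (𝓛)` in `S⁻¹Λ^ur` with `S ⊂ Λ⁺` ⟹ `𝔞 ⊂ (𝓛)`".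
[cite: YanZhu2024MainConjNonCM, proof of Thm. 4.2 (2) (arXiv:2412.20078v4 TeX l.1042–1050: "It implies that Char(𝒳_{𝓕_Gr}(E/K_∞))Λ_K^ur ⊂ (𝓛_p^Gr(E/K))")] -/
theorem le_span_of_span_map_C_mul_le_of_hasUnitContent_minus
    {G : PowerSeries (PowerSeries (PadicComplexInt p))} (hG : HasUnitContent (minus G))
    {t : PowerSeries (PadicComplexInt p)} (ht : t ≠ 0)
    {𝔞 : Ideal (PowerSeries (PowerSeries (PadicComplexInt p)))}
    (h : Ideal.span {PowerSeries.map (PowerSeries.C (R := PadicComplexInt p)) t} * 𝔞 ≤ Ideal.span {G}) :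
    𝔞 ≤ Ideal.span {G} := fun _ hc ↦
  Ideal.mem_span_singleton.mpr (dvd_of_dvd_map_C_mul_of_hasUnitContent_minus hG ht
    (Ideal.mem_span_singleton.mp (h (Ideal.mul_mem_mul (Ideal.mem_span_singleton_self _) hc))))

end Cancellation

end Literature.NumberTheory.EllipticCurves

/-! ## §C. Theorem 4.2 (2) "⊂" and Theorem 4.2 (1) "⊂" from their printed inputs -/

namespace Literature.NumberTheory.EllipticCurves.YanZhu2026

open IwasawaAlgebra₂ UnrSeries₂ GreenbergVatsal2000 BurungaleCastellaSkinner2025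

variable {p : ℕ} [Fact p.Prime]

/-- **Yan–Zhu 2026, Theorem 4.2 (2), the inclusion `Char_{Λ_K}(𝒳_{𝓕_Gr}(E/K_∞))Λ_K^ur ⊂ (𝓛_p^Gr(E/K))`
— PROVED from its printed inputs** (Cor. 4.6, Thm. 4.7, Prop. 3.14, [Hsieh14, Thm. B] via [BCS25,
Prop. 4.2.2]): granted the named facts `cor46_…`, `thm47_…AnyRoot…`, `prop314_…_anyRoot`,
`prop422_…`, under `GreenbergSetting ι W N K 𝔭 𝔭̄ κ₁ κ₂` (`p > 2` good ordinary split, `(N, D_K) = 1`,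
(disc), `(κ₁, κ₂)` = (cyc, anti)), the Heegner hypothesis and irreducibility of `ρ̄_E|_{G_K}`, for EVERY
Katz/Greenberg frame `(LK, G)` at `(γ₁⁻¹, γ₂⁻¹)` and every structure-compatible `J : ℤ_p → 𝒪_{ℂ_p}`:
`Char(X_Gr)·𝒪_{ℂ_p}⟦T₁,T₂⟧ ⊆ (G)`, `X_Gr = (W.baseChange K).XGr₂ p κ₁ κ₂ 𝔭̄ γ₁ γ₂` — the first step
(`exists_cyc_mul_charIdealXGr₂_le_of_thm47AnyRoot_of_cor46`) followed by the cancellation of the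
cyclotomic witness (`le_span_of_span_map_C_mul_le_of_hasUnitContent_minus`) against `μ(G⁻) = 0`
(`hasUnitContent_minus_of_prop314AnyRoot_of_prop422`). The embedding `ι₁` of the type-I frame is any
one compatible with `ι`.
[cite: YanZhu2024MainConjNonCM, Thm. 4.2 (2) (arXiv:2412.20078v4 TeX l.932–940) and its proof l.1036–1050, with Cor. 4.6 (l.996–1003), Thm. 4.7 (l.1022–1034), Prop. 3.14 (l.896–903)]
[cite: BurungaleCastellaSkinner2025, Prop. 4.2.2] [cite: Hsieh2014, Thm. B] -/
theorem charIdealXGr₂_map_le_span_of_facts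
    (h46 : cor46_XOrd₂_charIdeal_le_perrinRiou_awayFromPlus)
    (h47 : thm47_ord_localised_iff_greenbergAnyRoot_localised)
    (h314 : prop314_span_minus_eq_span_bdp_anyRoot) (h422 : prop422_exists_isBDPLFunction_mu_eq_zero)
    (ι₁ : integralClosure ℚ ℂ →+* ℂ_[p]) (ι : PadicAlgCl p ≃+* ℂ) (W : WeierstrassCurve ℚ) [W.IsElliptic]
    [W.IsGloballyMinimal] (K : Type) [Field K] [NumberField K] (v vbar : HeightOneSpectrum (𝓞 K))
    (κ₁ κ₂ : ZpExtension K p) (γ₁ γ₂ : absoluteGaloisGroup K)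
    [Fact (ZpExtension.IsTopGeneratorPair κ₁ κ₂ γ₁ γ₂)] {N : ℕ} [NeZero N]
    (π : ModularParametrizationData W N) [NeZero (NumberField.discr K).natAbs]
    (hset : GreenbergSetting ι W N K v vbar κ₁ κ₂) (hH : SatisfiesHeegnerHypothesis N K)
    (hirr : (W.baseChange K).HasIrreducibleModPGaloisRep p)
    (hι : ∀ z : integralClosure ℚ ℂ, ι₁ z = ((ι.symm (z : ℂ) : PadicAlgCl p) : ℂ_[p]))
    {Ω δ : ℂ} {Ωp : (unrIntegers p)ˣ} {LK G : PowerSeries (PowerSeries (PadicComplexInt p))}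
    (hLK : IsKatzMeasure₂ ι v vbar ∅ κ₁ κ₂ γ₁⁻¹ γ₂⁻¹ 1 Ω δ ((Ωp : unrIntegers p) : ℂ_[p]) LK)
    (hG : IsGreenbergLFunctionAnyRoot₂ ι v vbar κ₁ κ₂ γ₁⁻¹ γ₂⁻¹ π.f (NumberField.discr K).natAbs
      (NumberField.classNumber K) LK G)
    (J : ℤ_[p] →+* PadicComplexInt p)
    (hJ : ∀ x : ℤ_[p], ((J x : PadicComplexInt p) : ℂ_[p]) = ((x : ℚ_[p]) : ℂ_[p])) :
    (WeierstrassCurve.XGr₂.charIdeal (W.baseChange K) p κ₁ κ₂ vbar γ₁ γ₂).map (toUnr₂ p J) ≤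
      Ideal.span {G} := by
  -- first step: a nonzero cyclotomic witness `t` with `t · Char(X_Gr)𝒪 ⊆ (G)`
  obtain ⟨t, ht, hle⟩ := exists_cyc_mul_charIdealXGr₂_le_of_thm47AnyRoot_of_cor46 h47 h46 ι₁ ι W K
    v vbar κ₁ κ₂ γ₁ γ₂ π hset hirr hι hLK hG J hJ
  -- `μ(G⁻) = 0` (BCS Prop. 4.2.2 = Hsieh Thm. B + Prop. 3.14)
  have hU : HasUnitContent (minus G) := hasUnitContent_minus_of_prop314AnyRoot_of_prop422 h314 h422 ι
    W K v vbar κ₁ κ₂ γ₁ γ₂ π.isNewformOf hset hH hirr hLK hG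
  -- second step: cancel `t`
  exact le_span_of_span_map_C_mul_le_of_hasUnitContent_minus hU ht hle

/-- **Unconditional-in-`J` form** (a structure-compatible `J` exists: `exists_structureMap_padicInt`).
[cite: YanZhu2024MainConjNonCM, Thm. 4.2 (2) and its proof (arXiv:2412.20078v4 TeX l.932–940, l.1036–1050)] -/
theorem exists_structureMap_charIdealXGr₂_map_le_span_of_facts
    (h46 : cor46_XOrd₂_charIdeal_le_perrinRiou_awayFromPlus)
    (h47 : thm47_ord_localised_iff_greenbergAnyRoot_localised)
    (h314 : prop314_span_minus_eq_span_bdp_anyRoot) (h422 : prop422_exists_isBDPLFunction_mu_eq_zero)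
    (ι₁ : integralClosure ℚ ℂ →+* ℂ_[p]) (ι : PadicAlgCl p ≃+* ℂ) (W : WeierstrassCurve ℚ) [W.IsElliptic]
    [W.IsGloballyMinimal] (K : Type) [Field K] [NumberField K] (v vbar : HeightOneSpectrum (𝓞 K))
    (κ₁ κ₂ : ZpExtension K p) (γ₁ γ₂ : absoluteGaloisGroup K)
    [Fact (ZpExtension.IsTopGeneratorPair κ₁ κ₂ γ₁ γ₂)] {N : ℕ} [NeZero N]
    (π : ModularParametrizationData W N) [NeZero (NumberField.discr K).natAbs]
    (hset : GreenbergSetting ι W N K v vbar κ₁ κ₂) (hH : SatisfiesHeegnerHypothesis N K)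
    (hirr : (W.baseChange K).HasIrreducibleModPGaloisRep p)
    (hι : ∀ z : integralClosure ℚ ℂ, ι₁ z = ((ι.symm (z : ℂ) : PadicAlgCl p) : ℂ_[p]))
    {Ω δ : ℂ} {Ωp : (unrIntegers p)ˣ} {LK G : PowerSeries (PowerSeries (PadicComplexInt p))}
    (hLK : IsKatzMeasure₂ ι v vbar ∅ κ₁ κ₂ γ₁⁻¹ γ₂⁻¹ 1 Ω δ ((Ωp : unrIntegers p) : ℂ_[p]) LK)
    (hG : IsGreenbergLFunctionAnyRoot₂ ι v vbar κ₁ κ₂ γ₁⁻¹ γ₂⁻¹ π.f (NumberField.discr K).natAbs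
      (NumberField.classNumber K) LK G) :
    ∃ J : ℤ_[p] →+* PadicComplexInt p,
      (∀ x : ℤ_[p], ((J x : PadicComplexInt p) : ℂ_[p]) = ((x : ℚ_[p]) : ℂ_[p])) ∧
      (WeierstrassCurve.XGr₂.charIdeal (W.baseChange K) p κ₁ κ₂ vbar γ₁ γ₂).map (toUnr₂ p J) ≤
        Ideal.span {G} := by
  obtain ⟨J, hJ⟩ := exists_structureMap_padicInt (p := p)
  exact ⟨J, hJ, charIdealXGr₂_map_le_span_of_facts h46 h47 h314 h422 ι₁ ι W K v vbar κ₁ κ₂ γ₁ γ₂ π hset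
    hH hirr hι hLK hG J hJ⟩

/-- **Theorem 4.2 (2) "⊂" in the shape of the named fact `thm42_XGr₂_isTorsion_charIdeal_le_greenbergAnyRoot`'s
inclusion clause** (frames delivered by Thm. 3.9/Def. 3.11 = the named fact
`thm39_def311_exists_isGreenbergLFunctionAnyRoot₂`): granted the five refereed inputs, under
`GreenbergSetting` + (Heeg) + irreducibility of `ρ̄_E|_{G_K}` (print: absolute irreducibility, used only for
the (Im) equality), there are Katz/Greenberg frames `(Ω ≠ 0, δ² = ±D_K, Ω_p, LK, G)` such that along EVERY
structure-compatible `J`, `Char(X_Gr)·𝒪_{ℂ_p}⟦T₁,T₂⟧ ⊆ (G)`. (Torsion of `X_Gr` and the (Im) equality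
are not replayed here.)
[cite: YanZhu2024MainConjNonCM, Thm. 4.2 (2) (arXiv:2412.20078v4 TeX l.932–940), proof l.1036–1050, Thm. 3.9/Def. 3.11 (l.839–871)] -/
theorem exists_frames_charIdealXGr₂_map_le_span_of_facts
    (h39 : thm39_def311_exists_isGreenbergLFunctionAnyRoot₂)
    (h46 : cor46_XOrd₂_charIdeal_le_perrinRiou_awayFromPlus)
    (h47 : thm47_ord_localised_iff_greenbergAnyRoot_localised)
    (h314 : prop314_span_minus_eq_span_bdp_anyRoot) (h422 : prop422_exists_isBDPLFunction_mu_eq_zero)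
    (ι₁ : integralClosure ℚ ℂ →+* ℂ_[p]) (ι : PadicAlgCl p ≃+* ℂ) (W : WeierstrassCurve ℚ) [W.IsElliptic]
    [W.IsGloballyMinimal] (K : Type) [Field K] [NumberField K] (v vbar : HeightOneSpectrum (𝓞 K))
    (κ₁ κ₂ : ZpExtension K p) (γ₁ γ₂ : absoluteGaloisGroup K)
    [Fact (ZpExtension.IsTopGeneratorPair κ₁ κ₂ γ₁ γ₂)] {N : ℕ} [NeZero N]
    (π : ModularParametrizationData W N) [NeZero (NumberField.discr K).natAbs]
    (hset : GreenbergSetting ι W N K v vbar κ₁ κ₂) (hH : SatisfiesHeegnerHypothesis N K)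
    (hirr : (W.baseChange K).HasIrreducibleModPGaloisRep p)
    (hι : ∀ z : integralClosure ℚ ℂ, ι₁ z = ((ι.symm (z : ℂ) : PadicAlgCl p) : ℂ_[p])) :
    ∃ (Ω δ : ℂ) (Ωp : (unrIntegers p)ˣ) (LK G : PowerSeries (PowerSeries (PadicComplexInt p))),
      Ω ≠ 0 ∧ (δ ^ 2 = (NumberField.discr K : ℂ) ∨ δ ^ 2 = -(NumberField.discr K : ℂ)) ∧
      IsKatzMeasure₂ ι v vbar ∅ κ₁ κ₂ γ₁⁻¹ γ₂⁻¹ 1 Ω δ ((Ωp : unrIntegers p) : ℂ_[p]) LK ∧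
      IsGreenbergLFunctionAnyRoot₂ ι v vbar κ₁ κ₂ γ₁⁻¹ γ₂⁻¹ π.f (NumberField.discr K).natAbs
        (NumberField.classNumber K) LK G ∧
      ∀ J : ℤ_[p] →+* PadicComplexInt p,
        (∀ x : ℤ_[p], ((J x : PadicComplexInt p) : ℂ_[p]) = ((x : ℚ_[p]) : ℂ_[p])) →
        (WeierstrassCurve.XGr₂.charIdeal (W.baseChange K) p κ₁ κ₂ vbar γ₁ γ₂).map (toUnr₂ p J) ≤
          Ideal.span {G} := by
  obtain ⟨Ω, δ, Ωp, LK, G, hΩ, hδ, hLK, hG⟩ := h39 ι W K v vbar κ₁ κ₂ γ₁ γ₂ π.isNewformOf hset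
  exact ⟨Ω, δ, Ωp, LK, G, hΩ, hδ, hLK, hG, fun J hJ ↦ charIdealXGr₂_map_le_span_of_facts h46 h47 h314
    h422 ι₁ ι W K v vbar κ₁ κ₂ γ₁ γ₂ π hset hH hirr hι hLK hG J hJ⟩

/-- **Yan–Zhu 2026, Theorem 4.2 (1), the inclusion `Char_{Λ_K}(𝒳_{𝓕_ord}(E/K_∞)) ⊂ (𝓛_p^PR(E/K))` —
PROVED from the printed inputs** ("By Theorem 4.7 [with `S = {1}`] … Therefore (1) holds", l.1036–1050):
granted the five refereed named facts (Thm. 3.9/Def. 3.11 frames, Cor. 4.6, Thm. 4.7, Prop. 3.14,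
[BCS25, Prop. 4.2.2]), under `GreenbergSetting` + (Heeg) + irreducibility of `ρ̄_E|_{G_K}`, for EVERY
type-I frame `F = 𝓛_p^I(f_E/K)` (`IsHidaRankinLFunction ι₁ W κ₁ κ₂ π.f F ∧ IsCongruenceIntegral π.f F`):
`IdealLeSpan (Char(X_ord)) (𝓛_p^PR)` with `𝓛_p^PR = perrinRiouLFunction W π F`,
`X_ord = (W.baseChange K).XOrd₂ p κ₁ κ₂ γ₁ γ₂`. Compare `idealLeSpan_perrinRiou_of_thm47AnyRoot_of_thm42AnyRoot`
(same conclusion from the composite fact `thm42_…AnyRoot` and absolute irreducibility).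
[cite: YanZhu2024MainConjNonCM, Thm. 4.2 (1) (arXiv:2412.20078v4 TeX l.932–938) and proof l.1036–1050, Thm. 4.7 (l.1022–1034)] -/
theorem idealLeSpan_perrinRiou_of_facts
    (h39 : thm39_def311_exists_isGreenbergLFunctionAnyRoot₂)
    (h46 : cor46_XOrd₂_charIdeal_le_perrinRiou_awayFromPlus)
    (h47 : thm47_ord_localised_iff_greenbergAnyRoot_localised)
    (h314 : prop314_span_minus_eq_span_bdp_anyRoot) (h422 : prop422_exists_isBDPLFunction_mu_eq_zero)
    (ι₁ : integralClosure ℚ ℂ →+* ℂ_[p]) (ι : PadicAlgCl p ≃+* ℂ) (W : WeierstrassCurve ℚ) [W.IsElliptic]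
    [W.IsGloballyMinimal] (K : Type) [Field K] [NumberField K] (v vbar : HeightOneSpectrum (𝓞 K))
    (κ₁ κ₂ : ZpExtension K p) (γ₁ γ₂ : absoluteGaloisGroup K)
    [Fact (ZpExtension.IsTopGeneratorPair κ₁ κ₂ γ₁ γ₂)] {N : ℕ} [NeZero N]
    (π : ModularParametrizationData W N) [NeZero (NumberField.discr K).natAbs]
    (hset : GreenbergSetting ι W N K v vbar κ₁ κ₂) (hH : SatisfiesHeegnerHypothesis N K)
    (hirr : (W.baseChange K).HasIrreducibleModPGaloisRep p)
    (hι : ∀ z : integralClosure ℚ ℂ, ι₁ z = ((ι.symm (z : ℂ) : PadicAlgCl p) : ℂ_[p]))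
    {F : CycAntiSeries p} (hF : IsHidaRankinLFunction ι₁ W κ₁ κ₂ π.f F) (hcF : IsCongruenceIntegral π.f F) :
    IdealLeSpan (WeierstrassCurve.XOrd₂.charIdeal (W.baseChange K) p κ₁ κ₂ γ₁ γ₂)
      (perrinRiouLFunction W π F) := by
  obtain ⟨J, hJ⟩ := exists_structureMap_padicInt (p := p)
  obtain ⟨Ω, δ, Ωp, LK, G, -, -, hLK, hG, hle⟩ := exists_frames_charIdealXGr₂_map_le_span_of_facts h39
    h46 h47 h314 h422 ι₁ ι W K v vbar κ₁ κ₂ γ₁ γ₂ π hset hH hirr hι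
  have h := (h47 ι₁ ι W K v vbar κ₁ κ₂ γ₁ γ₂ π hset hirr hι F hF hcF Ω δ Ωp LK G hLK hG J hJ 1
    one_ne_zero).1
  rw [idealLeSpanAway_one_iff, map_one, exists_span_one_pow_mul_le_iff] at h
  exact h.mpr (hle J hJ)

/-! ## §D. The torsion clause of Theorem 4.2 (2), and the bundled `∃`-form without (Im) -/

/-- **Yan–Zhu 2026, Theorem 4.2 (2), torsion clause "`𝒳_{𝓕_Gr}(E/K_∞)` is `Λ_K`-torsion" — PROVED from
refereed inputs**: `X_ord` is torsion (Cor. 2.9, `cor29_XOrd₂_isTorsion`), `Char(X_ord) ⊂ (𝓛_p^PR)`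
(Thm. 4.2 (1) "⊂", `idealLeSpan_perrinRiou_of_facts`, from the five inputs), and the torsion transfer
ord → Gr of [BCS25, Thm. 4.1.3] at `S = {1}` (`BurungaleCastellaSkinner2025.xGr₂_isTorsion_of_thm413`);
the type-I frame needed by 4.1.3 is delivered by Cor. 4.6. Hypotheses: `GreenbergSetting` + (Heeg) +
irreducibility of `ρ̄_E|_{G_K}`, for every Katz/Greenberg frame `(LK, G)`.
[cite: YanZhu2024MainConjNonCM, Thm. 4.2 (2), torsion clause (arXiv:2412.20078v4 TeX l.939–940) with Cor. 2.9 (l.628–633) and proof l.1036–1050]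
[cite: BurungaleCastellaSkinner2025, Thm. 4.1.3 (§4.1, p. 8 of arXiv:2405.00270v2), torsion clauses] -/
theorem xGr₂_isTorsion_of_facts
    (h39 : thm39_def311_exists_isGreenbergLFunctionAnyRoot₂)
    (h46 : cor46_XOrd₂_charIdeal_le_perrinRiou_awayFromPlus)
    (h47 : thm47_ord_localised_iff_greenbergAnyRoot_localised)
    (h314 : prop314_span_minus_eq_span_bdp_anyRoot) (h422 : prop422_exists_isBDPLFunction_mu_eq_zero)
    (h29 : cor29_XOrd₂_isTorsion) (h413 : thm413_ord_torsion_dvd_iff_greenberg_torsion_dvd)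
    (ι₁ : integralClosure ℚ ℂ →+* ℂ_[p]) (ι : PadicAlgCl p ≃+* ℂ) (W : WeierstrassCurve ℚ) [W.IsElliptic]
    [W.IsGloballyMinimal] (K : Type) [Field K] [NumberField K] (v vbar : HeightOneSpectrum (𝓞 K))
    (κ₁ κ₂ : ZpExtension K p) (γ₁ γ₂ : absoluteGaloisGroup K)
    [Fact (ZpExtension.IsTopGeneratorPair κ₁ κ₂ γ₁ γ₂)] {N : ℕ} [NeZero N]
    (π : ModularParametrizationData W N) [NeZero (NumberField.discr K).natAbs]
    (hset : GreenbergSetting ι W N K v vbar κ₁ κ₂) (hH : SatisfiesHeegnerHypothesis N K)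
    (hirr : (W.baseChange K).HasIrreducibleModPGaloisRep p)
    (hι : ∀ z : integralClosure ℚ ℂ, ι₁ z = ((ι.symm (z : ℂ) : PadicAlgCl p) : ℂ_[p]))
    {Ω δ : ℂ} {Ωp : (unrIntegers p)ˣ} {LK G : PowerSeries (PowerSeries (PadicComplexInt p))}
    (hLK : IsKatzMeasure₂ ι v vbar ∅ κ₁ κ₂ γ₁⁻¹ γ₂⁻¹ 1 Ω δ ((Ωp : unrIntegers p) : ℂ_[p]) LK)
    (hG : IsGreenbergLFunctionAnyRoot₂ ι v vbar κ₁ κ₂ γ₁⁻¹ γ₂⁻¹ π.f (NumberField.discr K).natAbs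
      (NumberField.classNumber K) LK G) :
    Module.IsTorsion (IwasawaAlgebra₂ p) ((W.baseChange K).XGr₂ p κ₁ κ₂ vbar γ₁ γ₂) := by
  -- Cor. 4.6 delivers a type-I frame `F`
  have hN : (N : ℤ) = W.conductorNorm ℤ := hset.level
  obtain ⟨F, hF, hcF, -⟩ := h46 ι₁ W K κ₁ κ₂ γ₁ γ₂ π hset.three_le hset.goodOrd
    hset.isImaginaryQuadratic hset.split (hN ▸ hset.coprime) hirr hset.cyclotomic hset.anticyclotomic
  -- Cor. 2.9: `X_ord` is torsion
  have htor : Module.IsTorsion (IwasawaAlgebra₂ p) ((W.baseChange K).XOrd₂ p κ₁ κ₂ γ₁ γ₂) :=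
    h29 W K κ₁ κ₂ γ₁ γ₂ hset.three_le hset.goodOrd hset.isImaginaryQuadratic hset.split
      (hN ▸ hset.coprime) hirr
  -- Thm. 4.2 (1) "⊂" from the five inputs, then [BCS25, Thm. 4.1.3] at `S = {1}`
  obtain ⟨J, hJ⟩ := exists_structureMap_padicInt (p := p)
  exact xGr₂_isTorsion_of_thm413 ι₁ ι W v vbar κ₁ κ₂ γ₁ γ₂ π h413 hset hirr hι hF hcF hLK hG hJ htor
    (idealLeSpan_perrinRiou_of_facts h39 h46 h47 h314 h422 ι₁ ι W K v vbar κ₁ κ₂ γ₁ γ₂ π hset hH hirr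
      hι hF hcF)

/-- **Yan–Zhu 2026, Theorem 4.2 (2) WITHOUT its (Im) clause — the conclusion of the named fact
`thm42_XGr₂_isTorsion_charIdeal_le_greenbergAnyRoot` with the `BigIm` conjunct removed, PROVED from seven
refereed inputs** (Thm. 3.9/Def. 3.11 frames, Cor. 2.9, Cor. 4.6, Thm. 4.7, Prop. 3.14, [BCS25,
Prop. 4.2.2 = Hsieh Thm. B], [BCS25, Thm. 4.1.3]): under `GreenbergSetting` + (Heeg) + irreducibility of
`ρ̄_E|_{G_K}` (print: absolute irreducibility) there are Katz/Greenberg frames `(Ω ≠ 0, δ² = ±D_K, Ω_p,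
LK, G)` with `X_Gr` `Λ_K`-torsion and, along EVERY structure-compatible `J`, `Char(X_Gr)·𝒪_{ℂ_p}⟦T₁,T₂⟧
⊆ (G)`. The embedding `ι₁` of the type-I frames is any one compatible with `ι` (e.g. `ι⁻¹|_{ℤ̄}` completed).
[cite: YanZhu2024MainConjNonCM, Thm. 4.2 (2) (arXiv:2412.20078v4 TeX l.932–940) and proof l.1036–1050]
[cite: BurungaleCastellaSkinner2025, Thm. 4.1.3 and Prop. 4.2.2 (§4.1–4.2, pp. 8–9 of arXiv:2405.00270v2)] -/
theorem exists_frames_isTorsion_charIdealXGr₂_map_le_span_of_facts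
    (h39 : thm39_def311_exists_isGreenbergLFunctionAnyRoot₂)
    (h46 : cor46_XOrd₂_charIdeal_le_perrinRiou_awayFromPlus)
    (h47 : thm47_ord_localised_iff_greenbergAnyRoot_localised)
    (h314 : prop314_span_minus_eq_span_bdp_anyRoot) (h422 : prop422_exists_isBDPLFunction_mu_eq_zero)
    (h29 : cor29_XOrd₂_isTorsion) (h413 : thm413_ord_torsion_dvd_iff_greenberg_torsion_dvd)
    (ι₁ : integralClosure ℚ ℂ →+* ℂ_[p]) (ι : PadicAlgCl p ≃+* ℂ) (W : WeierstrassCurve ℚ) [W.IsElliptic]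
    [W.IsGloballyMinimal] (K : Type) [Field K] [NumberField K] (v vbar : HeightOneSpectrum (𝓞 K))
    (κ₁ κ₂ : ZpExtension K p) (γ₁ γ₂ : absoluteGaloisGroup K)
    [Fact (ZpExtension.IsTopGeneratorPair κ₁ κ₂ γ₁ γ₂)] {N : ℕ} [NeZero N]
    (π : ModularParametrizationData W N) [NeZero (NumberField.discr K).natAbs]
    (hset : GreenbergSetting ι W N K v vbar κ₁ κ₂) (hH : SatisfiesHeegnerHypothesis N K)
    (hirr : (W.baseChange K).HasIrreducibleModPGaloisRep p)
    (hι : ∀ z : integralClosure ℚ ℂ, ι₁ z = ((ι.symm (z : ℂ) : PadicAlgCl p) : ℂ_[p])) :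
    ∃ (Ω δ : ℂ) (Ωp : (unrIntegers p)ˣ) (LK G : PowerSeries (PowerSeries (PadicComplexInt p))),
      Ω ≠ 0 ∧ (δ ^ 2 = (NumberField.discr K : ℂ) ∨ δ ^ 2 = -(NumberField.discr K : ℂ)) ∧
      IsKatzMeasure₂ ι v vbar ∅ κ₁ κ₂ γ₁⁻¹ γ₂⁻¹ 1 Ω δ ((Ωp : unrIntegers p) : ℂ_[p]) LK ∧
      IsGreenbergLFunctionAnyRoot₂ ι v vbar κ₁ κ₂ γ₁⁻¹ γ₂⁻¹ π.f (NumberField.discr K).natAbs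
        (NumberField.classNumber K) LK G ∧
      Module.IsTorsion (IwasawaAlgebra₂ p) ((W.baseChange K).XGr₂ p κ₁ κ₂ vbar γ₁ γ₂) ∧
      ∀ J : ℤ_[p] →+* PadicComplexInt p,
        (∀ x : ℤ_[p], ((J x : PadicComplexInt p) : ℂ_[p]) = ((x : ℚ_[p]) : ℂ_[p])) →
        (WeierstrassCurve.XGr₂.charIdeal (W.baseChange K) p κ₁ κ₂ vbar γ₁ γ₂).map (toUnr₂ p J) ≤
          Ideal.span {G} := by
  obtain ⟨Ω, δ, Ωp, LK, G, hΩ, hδ, hLK, hG, hle⟩ := exists_frames_charIdealXGr₂_map_le_span_of_facts h39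
    h46 h47 h314 h422 ι₁ ι W K v vbar κ₁ κ₂ γ₁ γ₂ π hset hH hirr hι
  exact ⟨Ω, δ, Ωp, LK, G, hΩ, hδ, hLK, hG, xGr₂_isTorsion_of_facts h39 h46 h47 h314 h422 h29 h413 ι₁ ι W
    K v vbar κ₁ κ₂ γ₁ γ₂ π hset hH hirr hι hLK hG, hle⟩

/-! ## §E. "In `Λ_K ⊗ ℚ_p`" ⟹ "in `Λ_K`" when `μ(𝓛_p^Gr(E/K)⁻) = 0` (one curve, via Thm. 4.7 at `S = {pⁿ}`) -/

/-- **Rational ⟹ integral for ONE curve**: granted Thm. 4.7 (`thm47_…AnyRoot…`), under `GreenbergSetting`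
and irreducibility of `ρ̄_E|_{G_K}`, for a type-I frame `F`, a Katz/Greenberg frame `(LK, G)` at
`(γ₁⁻¹, γ₂⁻¹)` and a structure-compatible `J`: if the ordinary divisibility holds after inverting `p`
(`IdealLeSpanAway p (Char X_ord) (𝓛_p^PR)`, "in `Λ_K ⊗ ℚ_p`") and `μ(G⁻) = 0` (`HasUnitContent (minus G)`),
then BOTH integral divisibilities hold: `Char(X_Gr)·𝒪_{ℂ_p}⟦T₁,T₂⟧ ⊆ (G)` (Thm. 4.7 at `S = {pⁿ}`, then
the cancellation `le_span_of_span_map_C_mul_le_of_hasUnitContent_minus` with `t = pⁿ`) and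
`IdealLeSpan (Char X_ord) (𝓛_p^PR)` (Thm. 4.7 back at `S = {1}`). This is the mechanism of the printed
"`ord_P(𝓛_p^Gr(E/K)) = 0` for `P = P⁺Λ_K^ur`" at `P⁺ = (p)`, and of [BCS25, proof of Prop. 5.2.1, p. 10]
("Since `μ(…) = 0` … the divisibility holds integrally").
[cite: YanZhu2024MainConjNonCM, Thm. 4.7 (arXiv:2412.20078v4 TeX l.1022–1034) and proof of Thm. 4.2 (2) (l.1042–1050)]
[cite: BurungaleCastellaSkinner2025, proof of Prop. 5.2.1 (p. 10 of arXiv:2405.00270v2)] -/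
theorem idealLeSpan_and_charIdealXGr₂_map_le_span_of_rational_of_thm47_of_hasUnitContent_minus
    (h47 : thm47_ord_localised_iff_greenbergAnyRoot_localised)
    (ι₁ : integralClosure ℚ ℂ →+* ℂ_[p]) (ι : PadicAlgCl p ≃+* ℂ) (W : WeierstrassCurve ℚ) [W.IsElliptic]
    [W.IsGloballyMinimal] (K : Type) [Field K] [NumberField K] (v vbar : HeightOneSpectrum (𝓞 K))
    (κ₁ κ₂ : ZpExtension K p) (γ₁ γ₂ : absoluteGaloisGroup K)
    [Fact (ZpExtension.IsTopGeneratorPair κ₁ κ₂ γ₁ γ₂)] {N : ℕ} [NeZero N]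
    (π : ModularParametrizationData W N) [NeZero (NumberField.discr K).natAbs]
    (hset : GreenbergSetting ι W N K v vbar κ₁ κ₂) (hirr : (W.baseChange K).HasIrreducibleModPGaloisRep p)
    (hι : ∀ z : integralClosure ℚ ℂ, ι₁ z = ((ι.symm (z : ℂ) : PadicAlgCl p) : ℂ_[p]))
    {F : CycAntiSeries p} (hF : IsHidaRankinLFunction ι₁ W κ₁ κ₂ π.f F) (hcF : IsCongruenceIntegral π.f F)
    {Ω δ : ℂ} {Ωp : (unrIntegers p)ˣ} {LK G : PowerSeries (PowerSeries (PadicComplexInt p))}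
    (hLK : IsKatzMeasure₂ ι v vbar ∅ κ₁ κ₂ γ₁⁻¹ γ₂⁻¹ 1 Ω δ ((Ωp : unrIntegers p) : ℂ_[p]) LK)
    (hG : IsGreenbergLFunctionAnyRoot₂ ι v vbar κ₁ κ₂ γ₁⁻¹ γ₂⁻¹ π.f (NumberField.discr K).natAbs
      (NumberField.classNumber K) LK G)
    (J : ℤ_[p] →+* PadicComplexInt p)
    (hJ : ∀ x : ℤ_[p], ((J x : PadicComplexInt p) : ℂ_[p]) = ((x : ℚ_[p]) : ℂ_[p]))
    (hμ : HasUnitContent (minus G))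
    (hrat : IdealLeSpanAway (p : IwasawaAlgebra₂ p)
      (WeierstrassCurve.XOrd₂.charIdeal (W.baseChange K) p κ₁ κ₂ γ₁ γ₂) (perrinRiouLFunction W π F)) :
    IdealLeSpan (WeierstrassCurve.XOrd₂.charIdeal (W.baseChange K) p κ₁ κ₂ γ₁ γ₂)
        (perrinRiouLFunction W π F) ∧
      (WeierstrassCurve.XGr₂.charIdeal (W.baseChange K) p κ₁ κ₂ vbar γ₁ γ₂).map (toUnr₂ p J) ≤
        Ideal.span {G} := by
  -- `p ≠ 0` in `Λ_K` and in `𝒪_{ℂ_p}⟦T₁⟧`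
  have hp𝒪 : ((p : ℕ) : PadicComplexInt p) ≠ 0 := by
    intro h
    have h' : ((p : ℕ) : ℂ_[p]) = 0 := by exact_mod_cast congrArg ((↑) : PadicComplexInt p → ℂ_[p]) h
    exact (Nat.cast_ne_zero.mpr (Fact.out : p.Prime).ne_zero) h'
  have ht : ∀ n : ℕ, ((p : ℕ) : PowerSeries (PadicComplexInt p)) ^ n ≠ 0 := fun n ↦ by
    refine pow_ne_zero n ?_
    rw [← map_natCast (PowerSeries.C (R := PadicComplexInt p)), Ne,
      ← map_zero (PowerSeries.C (R := PadicComplexInt p)), (PowerSeries.C_injective).eq_iff]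
    exact hp𝒪
  have hp0 : (p : IwasawaAlgebra₂ p) ≠ 0 := by
    intro h
    have h1 := congrArg (toUnr₂ p J) h
    rw [map_natCast, map_zero, ← map_natCast (PowerSeries.C (R := PowerSeries (PadicComplexInt p))),
      ← map_zero (PowerSeries.C (R := PowerSeries (PadicComplexInt p))),
      (PowerSeries.C_injective).eq_iff] at h1
    exact ht 1 (by simpa using h1)
  -- Thm. 4.7 at `S = {pⁿ}`: the Greenberg divisibility after inverting `p`
  obtain ⟨n, hn⟩ := (h47 ι₁ ι W K v vbar κ₁ κ₂ γ₁ γ₂ π hset hirr hι F hF hcF Ω δ Ωp LK G hLK hG J hJ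
    (p : IwasawaAlgebra₂ p) hp0).1.mp hrat
  -- cancel `pⁿ` against `μ(G⁻) = 0`
  rw [map_natCast] at hn
  have hint : (WeierstrassCurve.XGr₂.charIdeal (W.baseChange K) p κ₁ κ₂ vbar γ₁ γ₂).map (toUnr₂ p J) ≤
      Ideal.span {G} := by
    refine le_span_of_span_map_C_mul_le_of_hasUnitContent_minus hμ (ht n) ?_
    rwa [map_pow, map_natCast]
  -- Thm. 4.7 back at `S = {1}`
  refine ⟨?_, hint⟩
  have h1 := (h47 ι₁ ι W K v vbar κ₁ κ₂ γ₁ γ₂ π hset hirr hι F hF hcF Ω δ Ωp LK G hLK hG J hJ 1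
    one_ne_zero).1
  rw [idealLeSpanAway_one_iff, map_one, exists_span_one_pow_mul_le_iff] at h1
  exact h1.mpr hint

end Literature.NumberTheory.EllipticCurves.YanZhu2026

end
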